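import Mathlib
import HarnessLib
import HarnessLib.Audit
import Summits.NavierStokesRegularity.Statement
import Literature.Analysis.FluidPDE.ClassicalSolution
import Literature.Analysis.FluidPDE.LerayHopf
import Literature.Analysis.FluidPDE.NSWave0
import Literature.Analysis.FluidPDE.SuitableWeak
import Literature.Analysis.FluidPDE.SelfSimilar
import Literature.Analysis.FluidPDE.LocalTypeI
import Literature.Analysis.FluidPDE.VectorCalculus
import Literature.Analysis.FluidPDE.Vorticity
import Literature.Analysis.FluidPDE.SereginSverak2002PressureLowerBound
import Literature.Analysis.FluidPDE.NSBoundedMildOseen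
import Literature.Analysis.UnboundedOperators.HeatKernel
import Summits.NavierStokesRegularity.NavierStokesRegularity.Theorems.LocalHelicityTubeDoorTarget
import Summits.NavierStokesRegularity.NavierStokesRegularity.Theorems.LocalHelicityTubeDoorFrobeniusWindowRigidityWindow
import HarnessLib.Audit.Status.Attr

/-!
Route: LocalHelicityTubeDoor

DORMANT since 2026-08-27T11:21:12Z (tenure p1 g15 (DIRECTOR-NS #28(2) agreed; LEAD p6 g9 released 19975 11:17Z): K2⁗ 19975 reduces to Liouville(𝔉) ⇐ TypeIAncientLiouville 4050 ⇐ 10661 (p517506; LEAD-CENSUS-g9 e45414f9: no decomposition ) — unstaffed, not closed; items shared with open routes are served there. `ledger route dormant <id> --off` reactivates.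

# Route LocalHelicityTubeDoor — local Type I plus FADING scale-normalised HELICITY DENSITY over one
similarity window forces regularity — via the Frobenius (complex-lamellar) class of Type-I profiles

RUNG-LEAF ROUTE (D-0061; leaf = the proposed rung N0-LocalTubeDoorHelicity of LADDER-NS = this
route's own `Target` item, the HELICITY-DENSITY WINDOW DOOR S11 of cell nsreg-p1 ROUND-11; it does
NOT claim Clay (A)). It suffices to show X = K1‴ ∧ K2⁗ where K1‴ = LocalPointZoomVelCurlSlices: at a
point x₀ where a classical Leray–Hopf flow is LOCALLY Type I (one parabolic cylinder) but not
backward bounded, one zoom sequence λ_j → 0⁺ of unit-viscosity rescalings converges pointwise, at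
EVERY slice s < 0, in velocity (λ_j/ν)·u(T + λ_j²s/ν, x₀ + λ_j y) → v(s,y) AND in vorticity
(λ_j²/ν)·curl u(·)(x₀ + λ_j y) → curl v(s)(y), to a Type-I-rate, continuous, Oseen-mild,
divergence-free profile v on (−∞,0) × ℝ³ with backward-singular apex (a TREE THEOREM,
`…Theorems.LocalHelicityTubeDoorLocalPointZoomVelCurlSlices.localPointZoomVelCurlSlices`); and K2⁗ =
FrobeniusProfileRigidity (OPEN): such a profile cannot have identically vanishing helicity density
⟪v(s,·), curl v(s,·)⟫ ≡ 0 on every slice unless its apex is regular. The leaf follows by the limit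
passage already proved in the tree
(`…Theorems.LocalHelicityTubeDoorTarget.localTubeDoorHelicity_of`: along the zoom times t_j = T +
λ_j²s/ν the scale-normalised window helicity density √(T−t_j)³⟪u, curl u⟫(t_j, x₀ + √(T−t_j)y)
converges pointwise to σ³ν²⟪v(s), curl v(s)⟫(σy), σ = √(−s)/√ν; Fatou and the L¹(U)-fading make it
vanish a.e. on σ•U, continuity everywhere on that open window) composed with window → slice by real
analyticity of Oseen-mild Type-I slices
(`…FrobeniusWindowRigidityWindow.frobeniusWindowRigidity_of_profileRigidity`): glue.lean `closes` is
that three-line composition.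
Lean:
`Summit.NavierStokesRegularity.NavierStokesRegularity.Theses.LocalHelicityTubeDoor.LocalPointZoomVelCurlSlices
∧
Summit.NavierStokesRegularity.NavierStokesRegularity.Theses.LocalHelicityTubeDoor.FrobeniusProfileRigidity`

## Assembly
The deciding theorem `closes` (glue.lean, three lines, certified by `ledger route check --native`):
`localTubeDoorHelicity_of h₁ (frobeniusWindowRigidity_of_profileRigidity h₂)` — the
Fatou-on-the-window limit passage for the PRODUCT of the two pointwise-convergent rescaled sequences
of K1‴ (tree, ≈ 200 lines, p6 g5) after the window → slice reduction of K2⁗ by slice analyticity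
(tree `helicityWindowToSlab`). The Assembly item only records the shape; K1‴, Assembly close at
birth by name, Target closes when K2⁗ does.

CLOSES_TARGET: closes rung N0-LocalTubeDoorHelicity of NavierStokesRegularity: Summit.NavierStokesRegularity.NavierStokesRegularity.Theses.LocalHelicityTubeDoor.Target (D-0061; not the summit Statement) — the deciding theorem of this route concludes that registered leaf instead of the Statement decl `NavierStokesRegularity` (class rung: servable and labelled, never counted as concluding the summit Statement).

Rationale: WHY THIS LINE. The door reads a PSEUDOSCALAR — the helicity density h = u·ω, scale-normalised as
(T−t)^{3/2}h on ONE similarity window — where the cell's born doors read the vorticity direction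
(LocalSineTubeDoor), one vorticity component (PoloidalWindowDoor, K2 open) or one velocity component
(LocalVelCompTubeDoor, closed·proved); its residue class 𝔉 = {Type-I Oseen-mild ancient v : v·curl v
≡ 0} (complex-lamellar / Frobenius-integrable velocity: v = φ∇ψ locally, vortex lines inside the
surfaces ψ = const) is the first of the cell's classes closed under the full rotation group, it
CONTAINS both classes where KNSS 2009 proved Liouville theorems (planar flows and axisymmetric flows
without swirl, arXiv:0709.3599 Thms 5.1/5.2) and EXCLUDES the swirl case (hard cores
AxisymSwirlRegular / AxisymmetricKatoGlobal: swirl makes v·ω ≢ 0). Engine for K2⁗ (cell ROUND-12 +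
LIT-PACK §R41/§R45): a helicity-free profile is real-analytic on every slice, so any local
degeneracy spreads slice-wide, and the strata theorems already in the tree settle every symmetric
stratum on ONE slice — vorticity parallel to a fixed direction (`eq_zero_of_aligned`),
translation-invariance along a line (`nonflatLiouville_of_translate_eq_slice`),
axisymmetric-without-swirl about any axis (`eq_zero_of_axisymmetric_noSwirl_anyAxis_slice`, KNSS Thm
5.2 transported), strict shadow (`not_backwardSingular_of_inner_eq_zero` = S10's K2′),
scale-invariance, time-periodicity (kernel reduction `frobeniusProfileRigidity_of_sharper`); what
remains is ONE classification statement, the slice quadrichotomy S12 (every 𝔉-profile has a slice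
that is vorticity-aligned, translation-invariant, axisymmetric-swirl-free, or carries a ball on
which curl v is an affine screw field k(d×(y−c) + h d)), whose fourth stratum is empty on profiles
by an elementary growth argument (bounded analytic slice vorticity cannot continue an affine field;
§R45) and whose first three are the tree strata. Imported: the blow-up zoom of Albritton–Barker
arXiv:1811.00502 (tree K1‴), KNSS's Liouville theorems arXiv:0709.3599, the printed classification
of steady universal complex-lamellar NS motions Marris–Ames 1977 (ARMA 64, Main Theorem p. 372; lit
key paper:url-ec4639406ba5) whose third, HELICOIDAL class (I.2) is exactly why S12 needs the fourth
stratum (it refutes the three-stratum LOCAL germ classification, LIT-PACK §R41, kit j255916), the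
helical no-swirl identities of Ettinger–Titi arXiv:0802.2131 Lemma 2.11 and
Jiu–Lopes–Niu–Nussenzveig Lopes arXiv:1706.10012 §4, and the cell's numerical Cartan-character
census of 𝔉 (ROUND-12: no fourth local class through planar / unidirectional / axisymmetric-no-swirl
jets, exact mod-p certificates j255917/j256156/j256248). In print, helicity-type REGULARITY CRITERIA
are global or two-point: Berselli–Córdoba doi:10.1016/j.crma.2009.03.003 Thm 2.1 p. 4 / Thm 3.1 p. 6
(|u(x+y,t)·ω(x,t)| ≤ c₁|y| |u||ω| for ALL x and all small y, a.e. t — Lipschitz near-orthogonality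
everywhere; or a small global angle defect), Farhat–Grujić arXiv:1804.08238 Thm 1 (local
near-BELTRAMI: sin∠(u,ω) small on the high-vorticity set weighted by local enstrophy — the opposite
side), Chae 2010 (u×ω ∈ L^{3,∞}, global), Beirão da Veiga 2012 (global near-Beltrami); a ONE-POINT,
ONE-WINDOW, o(1)-in-L¹ criterion on the scale-normalised helicity density under LOCAL Type I, with
the complex-lamellar Type-I profile class as residue, is in none of them. What it does that the
cell's other routes do not: its open crux is a CLASSIFICATION question about an integrable Pfaffian
class (Frobenius), attackable by exterior differential systems / Cartan–Kähler counting and by the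
strata-Liouville kit, not a Liouville theorem for a general bounded ancient flow (hard core
TypeIliouvilleL, evaded: K2⁗ is (L) restricted to 𝔉).

RANKED CRUXES. #0 Target (target) — the leaf LocalTubeDoorHelicity (S11; statement = conclusion of
the tree theorem `…LocalHelicityTubeDoorTarget.localTubeDoorHelicity_of_windowRigidity`): classical
NS solution on [0,T), Leray–Hopf from a rapidly decaying datum, locally Type I at (x₀,T) on B(x₀,ρ)
× ((T−ρ²)∨0, T); if for ONE nonempty open window U of similarity coordinates the scale-normalised
helicity density fades in L¹, ∫_U |√(T−t)³ ⟪u(t), curl u(t)⟫(x₀+√(T−t)y)| dy → 0 as t → T⁻, then u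
is backward bounded at (x₀,T). (why it might fail: only through K2⁗: a locally Type-I singularity
whose blow-up profiles are helicity-free (complex-lamellar) on the window is excluded exactly when 𝔉
carries no backward-singular Type-I profile — open (S12 quadrichotomy); K1‴ and the limit passage
are tree theorems.) [arXiv:0709.3599, arXiv:1811.00502, doi:10.1016/j.crma.2009.03.003,
arXiv:1804.08238]
#2 FrobeniusProfileRigidity (crux) — RIGIDITY OF HELICITY-FREE (COMPLEX-LAMELLAR) TYPE-I PROFILES,
K2⁗ in profile form (= hypothesis `hprofile` of the tree theorem
`…LocalHelicityTubeDoorTarget.localTubeDoorHelicity_of_profileRigidity`, verbatim). If v : (−∞,0) ×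
ℝ³ → ℝ³ has the Type-I time rate ‖v(t,x)‖ ≤ C/√(−t), is continuous on the open slab, unit-viscosity
Oseen-mild between negative times and divergence-free, and its helicity density ⟪v(s,y), curl
v(s)(y)⟫ vanishes for every s < 0 and every y, then v is not backward-singular at the apex (0,0).
Settled strata (tree): vorticity-aligned slice, translation-invariant slice, axisymmetric-swirl-free
slice about any axis, strict shadow, scale-invariant, time-periodic
(`frobeniusProfileRigidity_of_sharper`); line of record = the slice quadrichotomy S12 (BC3 skeleton
bc/FrobeniusProfileRigidity_birth.lean: stub_sliceQuadrichotomy OPEN, stub_screwSliceRigidity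
provable, composition proved). [difficulty: open-problem] (why it might fail: a genuinely 3-D
helicity-free bounded ancient NS flow off every symmetric stratum — the local germ classification of
𝔉 is open-ended (Marris–Ames 1977 (I.2) already adds a helicoidal class to
plane/axisymmetric/parallel), and swirling Strakhovitch jets are unsampled by the Cartan census.)
[arXiv:0709.3599, paper:url-ec4639406ba5, arXiv:0802.2131, arXiv:1706.10012, arXiv:2312.10382]
#3 LocalPointZoomVelCurlSlices (crux) — LOCAL POINT ZOOM LIMIT WITH VELOCITY AND VORTICITY SLICES,
K1‴ (= the statement of the tree theorem
`…Theorems.LocalHelicityTubeDoorLocalPointZoomVelCurlSlices.localPointZoomVelCurlSlices`, verbatim;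
closes at birth by that name). For a classical NS solution on [0,T) (Leray–Hopf, rapidly decaying
datum) that is locally Type I at (x₀,T) on one parabolic cylinder but NOT backward bounded at
(x₀,T), there are C, a profile v and λ_j → 0⁺ such that v has the Type-I time rate, is continuous on
(−∞,0) × ℝ³, satisfies the unit-viscosity Oseen–Duhamel identity between negative times, is
divergence-free, is backward-singular at (0,0), and for EVERY s < 0 and every y both the rescaled
velocities (λ_j/ν)·u(T + λ_j²s/ν, x₀ + λ_j y) → v(s,y) and the rescaled vorticities (λ_j²/ν)·curl
u(T + λ_j²s/ν)(x₀ + λ_j y) → curl v(s)(y). [difficulty: provable-now] (why it might fail: it cannot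
as typed — it is the statement of the accepted tree theorem `localPointZoomVelCurlSlices` (p6 g5);
the only risk is a render mismatch of the item text against that theorem's type (then a one-line
`exact` with `show`).) [arXiv:1811.00502, arXiv:0709.3599, Seregin2014]

TWO-LAYER PLAN. Foreseen glued split of FrobeniusProfileRigidity = the registered birth skeleton
(bc/FrobeniusProfileRigidity_birth.lean, kernel composition `FrobeniusProfileRigidity_of`, lean rc
0, sorries = 2 stubs): stub_sliceQuadrichotomy (S12, OPEN, the ONE load-bearing classification
statement: a profile of the class with ⟪v, curl v⟫ ≡ 0 has a slice s < 0 on which vorticity is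
parallel to a fixed nonzero direction, OR the slice is invariant under translations along a line, OR
it is axisymmetric without swirl about some axis (any direction, any centre), OR curl v(s) equals an
affine screw field k(d×(y−c) + h d), k ≠ 0, d ≠ 0, on a nonempty open ball) →
stub_screwSliceRigidity (provable, M: the fourth alternative forces ¬ backward-singular — real
analyticity of the slice vorticity (`analyticOnNhd_slice_of_oseenMild`) continues the affine field
to all of ℝ³, contradicting the slice derivative bounds `exists_norm_iteratedFDeriv_slice_le` unless
k = 0) → FrobeniusProfileRigidity, the first three alternatives being discharged inside the
composition by the tree strata theorems `eq_zero_of_aligned`,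
`nonflatLiouville_of_translate_eq_slice`, `eq_zero_of_axisymmetric_noSwirl_anyAxis_slice`. Foreseen
split of stub_sliceQuadrichotomy one level down (for the crux-plan seat, not items): local germ
quadrichotomy for helicity-free NS germs (exterior differential system of 𝔉, Cartan characters
certified numerically in ROUND-12; print anchor Marris–Ames 1977 for the universal sub-class) + germ
→ slice spreading by analyticity. No split of LocalPointZoomVelCurlSlices (tree theorem).

KILL CRITERIA. A refutation of FrobeniusProfileRigidity AS TYPED — a backward-singular, Type-I-rate,
Oseen-mild, divergence-free ancient flow with ⟪v, curl v⟫ ≡ 0 on every slice — closes the route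
(close --reason refuted:FrobeniusProfileRigidity) and is itself a prize object (the first genuinely
three-dimensional bounded ancient complex-lamellar NS flow; it would also kill every «helicity-free
⇒ regular» heuristic). A refutation of stub_sliceQuadrichotomy alone (a helicity-free Type-I profile
off all four strata but with regular apex, or a fifth local germ class of 𝔉 found by the Cartan
census at swirling Strakhovitch jets, STOP RULE 2 of ROUND-12) kills the LINE, not the route: K2⁗
then needs a Liouville input beyond classification and the route is re-lined or parked dormant.
LocalPointZoomVelCurlSlices cannot be refuted (tree theorem). Proved elsewhere that moots it:
TypeIliouvilleL (stmt-10661) or local Type-I exclusion makes the leaf a corollary; Clay (A) moots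
everything.

NOT DECOMPOSED YET. K2⁗ is kept as ONE crux although its line has two stubs: the second (screw-slice
rigidity) is an M-sized analytic-continuation lemma and the first (slice quadrichotomy) is the whole
open content — filing them as items would shred the crux and put a classification conjecture on the
ledger before its Cartan census has sampled the swirling Strakhovitch base points (ROUND-13 Day 1).
The strata already settled are tree theorems, cited by name, not items. K1‴ is one crux exactly as
the sibling doors' K1/K1′ (shared zoom machinery; here already a tree theorem).

CHEAPEST FALSIFIER. In print (ran, LIT-PACK §R41, kit j255916 exact sympy certificate): Marris–Ames
1977 (I.2) is a steady NS solution for every ν with v·curl v ≡ 0, curl v = k(−y, x, a) ≠ 0, outside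
the plane/axisymmetric-no-swirl/parallel strata — it REFUTES the three-stratum local germ
classification (cell `FrobeniusLocalTrichotomy`, never filed) and is the reason S12 carries the
fourth (screw) stratum; it does NOT touch K2⁗ (unbounded: log r and r² growth, multivalued θ-branch;
affine vorticity is impossible on a profile slice — stub_screwSliceRigidity). In Lean (ran, kernel):
`frobeniusProfileRigidity_of_sharper` (tree) and `FrobeniusProfileRigidity_of` (birth skeleton, rc
0) leave the refuter exactly one target: a Type-I Oseen-mild helicity-free ancient flow with NO
degenerate slice of the four kinds. Cheapest numerical kill of the line: the ROUND-12 Cartan census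
restarted at a swirling Strakhovitch jet (I.1) (one kit job, ≈ 1 core-h): an integrable excess
direction there beyond the helicoidal family = a fifth local class = STOP RULE 2.

NUMBERS. No thresholds: the leaf is qualitative and scale-invariant (window U of any size anywhere
in similarity coordinates, not required to contain y = 0; fading = o(1) in L¹(U) of the
dimensionless density (T−t)^{3/2} u·ω; local Type-I constant M arbitrary). Printed comparators:
Berselli–Córdoba 2009 Thm 2.1 needs |u(x+y,t)·ω(x,t)| ≤ c₁|y| |u(x+y,t)| |ω(x,t)| for a.e. t, ALL x
∈ 𝕋³ and all small y (datum in H⁴), Thm 3.1(b) a small constant c₂(ν, ‖u₀‖_{H¹}) in |u·ω| ≤ c₂|u||ω|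
globally; Farhat–Grujić 2018 Thm 1 needs sup_{B(x₀,2r)} sin∠(ω,u) · ‖∇u‖^{1/2}_{L²({|ω|>M})} ≤ c on
a parabolic cylinder (near-Beltrami, the opposite regime). Cartan census of 𝔉 (ROUND-12, steady, NP
= 14/16/18, spectral gaps 10⁷–3·10⁹, exact mod-p confirmation at two primes): planar jets — family +
exactly 2 integrable directions (axis moduli of the axisymmetric-no-swirl deformation);
unidirectional jets — family + exactly 2 first-order directions, nilpotent at order 2;
axisymmetric-no-swirl jets — family + exactly 2 (axis tilt/shift); no function-count excess at any
sampled stratum. BC9 for the tribunal: method_family = blow-up zoom + slice-degeneracy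
classification of the Frobenius class + KNSS maximum-principle Liouville on strata + slice
real-analyticity; ceiling in print = KNSS 2009 Thms 5.1/5.2 and Han–Wang–Xie arXiv:2312.10382 Thm
1.1 (steady helical) — capped at strata carrying a continuous symmetry or a stretching-free scalar;
ceiling_lift = the slice quadrichotomy (stub_sliceQuadrichotomy of the K2⁗ skeleton); one rung above
sits the hard core TypeIliouvilleL (stmt-10661), not claimed.

DEFINITION REQUESTS. None: every constant exists (IsClassicalNSSolutionOn, IsLerayHopfOn,
HasRapidSpatialDecay, IsBackwardBoundedAt, IsBackwardSingularPoint, HasTypeITimeDecay,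
UnboundedOperators.heatExtension, oseenDuhamel, VectorCalculus.IsDivFree, curl, ENNReal.ofReal,
MeasureTheory.lintegral, inner — `lean search --decl` each; the three item texts are the binder
types of accepted tree theorems and elaborate in the native render). Leaf registration request
(D-0061, LIST 3):
`Summit.NavierStokesRegularity.NavierStokesRegularity.Theses.LocalHelicityTubeDoor.Target` as rung
leaf N0-LocalTubeDoorHelicity (PATH (ii): the born item decl is the door) — the director's MINT, not
this seat's.

Novelty: Searches (2026-08-26 09:45Z g9 + 19:40Z g11, this seat; OpenAlex/S2 HTTP 429 both days — external
graph search NOT run, Crossref answered): `lit search --hybrid "Berselli Córdoba orthogonality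
velocity vorticity regularity Navier-Stokes"` → textbooks only
([corpus:book:majda2002-vorticity-incompressible-flow pp 42–45] kinematics,
[corpus:book:lemarie-rieusset2016-navier-stokes-problem-21st-century p 770],
[corpus:book:seregin2014-lecture-notes-regularity-theory-navier-stokes-equations p 103]) — null for
a criterion; `lit search "Berselli Córdoba geometric constraints … 2009" --source all` →
[corpus:paper:doi-10-1016-j-crma-2009-03-003 pp 1,3,4,6] (READ: Thm 2.1 p 4, Thm 3.1 p 6 quoted in
Numbers), [corpus:paper:doi-10-3934-dcdss-2019014 p 9], [corpus:paper:arxiv-1606.08126 p 9],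
Crossref doi:10.1088/0951-7715/22/10/013 (Berselli 2009 Nonlinearity),
doi:10.1007/s11565-009-0076-2; `lit vsearch` (papers) of the K2⁗ statement in prose → 0 docs; corpus
fts «complex lamellar» (g9) → 8 docs, all porous-media / continuum-kinematics
([corpus:paper:doi-10-1007-s11242-019-01346-3 pp 8–9]); `lit galaxy search "helicity
density|orthogonality of velocity and vorticity|velocity orthogonal to the vorticity" --star all` →
30 rows (visualisation / MHD / chiral-plasma / turbulence textbooks, e.g.
[galaxy:panama:335883622416452] Davidson, [galaxy:pdf:-8755194745379033740] Beltrami statistical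
mechanics) — null for NS regularity; g9 galaxy «complex lamellar|complex-lamellar» →
[galaxy:panama:5120  [refs: 10.1088/0951-7715/22/10/013, 10.1007/s11565-009-0076-2, 10.1016/j.crma.2009.03.003, 0802.2131, 1706.10012, 2312.10382, 1804.08238, 0709.3599, book:majda2002-vorticity-incompressible-flow, book:lemarie-rieusset2016-navier-stokes-problem-21st-century, book:seregin2014-lecture-notes-regularity-theory-navier-stokes-equations, paper:doi-10-1016-j-crma-2009-03-003, paper:doi-10-3934-dcdss-2019014, paper]

Barriers (technique_class: helicity-density, zoom-compactness, frobenius-strata): - technique_class: helicity-density, blow-up-zoom-compactness, degeneracy-stratum,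
knss-maximum-principle-liouville, real-analyticity, frobenius-integrability, type-I-criterion
- Literature.Barriers.NavierStokesRegularity.AveragedTypeIBlowup: OUTSIDE its class — the barrier
blocks Type-I EXCLUSION by averaging-insensitive (energy identity + harmonic analysis) arguments;
the leaf is a CRITERION whose engine is the pointwise structure v·curl v of the genuine solution,
the vorticity transport equation, KNSS's strong maximum principle on symmetric strata and real
analyticity of mild bounded ancient slices — Tao's averaged bilinear form has no vorticity equation,
no Frobenius class and no strata Liouville theorems; no claim is made about all solutions.
- Literature.Barriers.NavierStokesRegularity.TaoAveragedBlowup: same placement (the mechanism is not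
expressible for the averaged equation; the route asserts regularity only under a fine-structure
hypothesis at a locally Type-I point).
- Literature.Barriers.NavierStokesRegularity.HyperdissipativeAveragedBlowup: same family, same
placement.
- Literature.Barriers.NavierStokesRegularity.AxisymmetricTypeIExclusion: consistent, not threatened
— the axisymmetric-without-swirl stratum of 𝔉 is settled in the tree in agreement with it; the swirl
case it also covers lies OUTSIDE 𝔉 (swirl ⇒ v·ω ≢ 0), so the door neither uses nor contradicts it.
- Literature.Barriers.NavierStokesRegularity.NavierStokesInequalitySingularSolution: OUTSIDE — Schef

History (route lifecycle, newest last):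
- 2026-08-27T03:56:04Z · closes_target -> closes rung N0-LocalTubeDoorHelicity of NavierStokesRegularity: Summit.NavierStokesRegularity.NavierStokesRegularity.Theses.LocalHelicityTubeDoor.Target (D-0061; not the summit Statement) (operator:999:335813)
- 2026-08-27T11:21:12Z · DORMANT — tenure p1 g15 (DIRECTOR-NS #28(2) agreed; LEAD p6 g9 released 19975 11:17Z): K2⁗ 19975 reduces to Liouville(𝔉) ⇐ TypeIAncientLiouville 4050 ⇐ 10661 (p517506; LE (planner-ns-regularity-ideate-p1-g15-0)

sub-problem: NavierStokesRegularity · status: dormant · opened operator:999:1898382 2026-08-27T03:34:42Z · rev 2 · ledger route-NavierStokesRegularity-LocalHelicityTubeDoor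
GENERATED by the gate from the ledger (D-0016/17). Provers cite these decls: `theorem foo : Summit.NavierStokesRegularity.NavierStokesRegularity.Theses.LocalHelicityTubeDoor.<Decl> := …` in Summits/NavierStokesRegularity/NavierStokesRegularity/Theorems/<Name>.lean.
-/

namespace Summit.NavierStokesRegularity.NavierStokesRegularity.Theses.LocalHelicityTubeDoor

open scoped BigOperators Topology Manifold Classical MeasureTheory ProbabilityTheory Matrix InnerProductSpace ComplexConjugate ContinuousMap
open Filter Set Function TopologicalSpace MeasureTheory

attribute [summit_statement] _root_.NavierStokesRegularity
-- H21.Audit: the closer leaf Summit.NavierStokesRegularity.NavierStokesRegularity.Theses.LocalHelicityTubeDoor.Target is an item decl of this route file — tagged summit_statement below, after its declaration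

open Literature.NS

/-- item stmt-NavierStokesRegularity-19975 · crux · rank 2 · open · by operator
why it might fail: a genuinely 3-D helicity-free bounded ancient NS flow off every symmetric stratum — the local germ classification of 𝔉 is open-ended (Marris–Ames 1977 (I.2) already adds a helicoidal class to plane/axisymmetric/parallel), and swirling Strakhovitch jets are unsampled by the Cartan census.
sources: arXiv:0709.3599, paper:url-ec4639406ba5, arXiv:0802.2131, arXiv:1706.10012, arXiv:2312.10382
[crux] RIGIDITY OF HELICITY-FREE (COMPLEX-LAMELLAR) TYPE-I PROFILES, K2⁗ in profile form (=
hypothesis `hprofile` of the tree theorem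
`…LocalHelicityTubeDoorTarget.localTubeDoorHelicity_of_profileRigidity`, verbatim). If v : (−∞,0) ×
ℝ³ → ℝ³ has the Type-I time rate ‖v(t,x)‖ ≤ C/√(−t), is continuous on the open slab, unit-viscosity
Oseen-mild between negative times and divergence-free, and its helicity density ⟪v(s,y), curl
v(s)(y)⟫ vanishes for every s < 0 and every y, then v is not backward-singular at the apex (0,0).
Settled strata (tree): vorticity-aligned slice, translation-invariant slice, axisymmetric-swirl-free
slice about any axis, strict shadow, scale-invariant, time-periodic
(`frobeniusProfileRigidity_of_sharper`); line of record = the slice quadrichotomy S12 (BC3 skeleton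
bc/FrobeniusProfileRigidity_birth.lean: stub_sliceQuadrichotomy OPEN, stub_screwSliceRigidity
provable, composition proved). [difficulty: open-problem] -/
@[route_item "route-NavierStokesRegularity-LocalHelicityTubeDoor", crux]
def FrobeniusProfileRigidity : Prop :=
  ∀ (C : ℝ) (v : ℝ → EuclideanSpace ℝ (Fin 3) → EuclideanSpace ℝ (Fin 3)), Literature.Analysis.FluidPDE.HasTypeITimeDecay C v → ContinuousOn (Function.uncurry v) (Set.Iio (0 : ℝ) ×ˢ Set.univ) → (∀ s t : ℝ, s < t → t < 0 → ∀ x, v t x = Literature.Analysis.UnboundedOperators.heatExtension (v s) (t - s) x - Literature.Analysis.FluidPDE.oseenDuhamel 1 s v v t x) → (∀ t < 0, Literature.Analysis.FluidPDE.VectorCalculus.IsDivFree (v t)) → (∀ s < 0, ∀ y : EuclideanSpace ℝ (Fin 3), inner ℝ (v s y) (Literature.Analysis.FluidPDE.curl (v s) y) = 0) → ¬ Literature.Analysis.FluidPDE.IsBackwardSingularPoint v 0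

/-- item stmt-NavierStokesRegularity-19976 · crux · rank 3 · closed · proved by Summit.NavierStokesRegularity.NavierStokesRegularity.Theorems.LocalHelicityTubeDoorLocalPointZoomVelCurlSlicesClose.localPointZoomVelCurlSlices_proof (prover) · by operator
why it might fail: it cannot as typed — it is the statement of the accepted tree theorem `localPointZoomVelCurlSlices` (p6 g5); the only risk is a render mismatch of the item text against that theorem's type (then a one-line `exact` with `show`).
sources: arXiv:1811.00502, arXiv:0709.3599, Seregin2014
[crux] LOCAL POINT ZOOM LIMIT WITH VELOCITY AND VORTICITY SLICES, K1‴ (= the statement of the tree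
theorem `…Theorems.LocalHelicityTubeDoorLocalPointZoomVelCurlSlices.localPointZoomVelCurlSlices`,
verbatim; closes at birth by that name). For a classical NS solution on [0,T) (Leray–Hopf, rapidly
decaying datum) that is locally Type I at (x₀,T) on one parabolic cylinder but NOT backward bounded
at (x₀,T), there are C, a profile v and λ_j → 0⁺ such that v has the Type-I time rate, is continuous
on (−∞,0) × ℝ³, satisfies the unit-viscosity Oseen–Duhamel identity between negative times, is
divergence-free, is backward-singular at (0,0), and for EVERY s < 0 and every y both the rescaled
velocities (λ_j/ν)·u(T + λ_j²s/ν, x₀ + λ_j y) → v(s,y) and the rescaled vorticities (λ_j²/ν)·curl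
u(T + λ_j²s/ν)(x₀ + λ_j y) → curl v(s)(y). [difficulty: provable-now] -/
@[route_item "route-NavierStokesRegularity-LocalHelicityTubeDoor", crux]
def LocalPointZoomVelCurlSlices : Prop :=
  ∀ (ν T : ℝ), 0 < ν → 0 < T → ∀ (u : ℝ → EuclideanSpace ℝ (Fin 3) → EuclideanSpace ℝ (Fin 3)) (p : ℝ → EuclideanSpace ℝ (Fin 3) → ℝ), Literature.Analysis.FluidPDE.IsClassicalNSSolutionOn (Set.Ico 0 T) ν 0 u p → Literature.Analysis.FluidPDE.IsLerayHopfOn T ν 0 (u 0) u → Literature.Analysis.FluidPDE.HasRapidSpatialDecay (u 0) → ∀ (x₀ : EuclideanSpace ℝ (Fin 3)) (ρ M : ℝ), 0 < ρ → (∀ t ∈ Set.Ico 0 T, T - ρ ^ 2 < t → ∀ x ∈ Metric.ball x₀ ρ, ‖u t x‖ * Real.sqrt (ν * (T - t)) ≤ M) → ¬ Literature.Analysis.FluidPDE.IsBackwardBoundedAt u T x₀ → ∃ (C : ℝ) (v : ℝ → EuclideanSpace ℝ (Fin 3) → EuclideanSpace ℝ (Fin 3)) (lam : ℕ → ℝ),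 (∀ j, 0 < lam j) ∧ Filter.Tendsto lam Filter.atTop (nhds 0) ∧ (Literature.Analysis.FluidPDE.HasTypeITimeDecay C v ∧ ContinuousOn (Function.uncurry v) (Set.Iio (0 : ℝ) ×ˢ Set.univ) ∧ (∀ s t : ℝ, s < t → t < 0 → ∀ x, v t x = Literature.Analysis.UnboundedOperators.heatExtension (v s) (t - s) x - Literature.Analysis.FluidPDE.oseenDuhamel 1 s v v t x) ∧ (∀ t < 0, Literature.Analysis.FluidPDE.VectorCalculus.IsDivFree (v t))) ∧ Literature.Analysis.FluidPDE.IsBackwardSingularPoint v 0 ∧ ∀ s < 0, ∀ y, Filter.Tendsto (fun j => (lam j / ν) • u (T + lam j ^ 2 * s / ν) (x₀ + lam j • y)) Filter.atTop (nhds (v s y)) ∧ Filter.Tendsto (fun j => (lam j ^ 2 / ν) • Literature.Analysis.FluidPDE.curl (u (T + lam j ^ 2 * s / ν)) (x₀ + lam j • y)) Filter.atTop (nhds (Literature.Analysis.FluidPDE.curl (v s) y))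

-- `LocalPointZoomVelCurlSlices` holds: proved by `Summit.NavierStokesRegularity.NavierStokesRegularity.Theorems.LocalHelicityTubeDoorLocalPointZoomVelCurlSlicesClose.localPointZoomVelCurlSlices_proof` (its module imports this route file, so no `_holds` link can be stated here).

/-- item stmt-NavierStokesRegularity-19974 · aside · rank 0 · open · by operator
why it might fail: only through K2⁗: a locally Type-I singularity whose blow-up profiles are helicity-free (complex-lamellar) on the window is excluded exactly when 𝔉 carries no backward-singular Type-I profile — open (S12 quadrichotomy); K1‴ and the limit passage are tree theorems.
sources: arXiv:0709.3599, arXiv:1811.00502, doi:10.1016/j.crma.2009.03.003, arXiv:1804.08238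
[target] the leaf LocalTubeDoorHelicity (S11; statement = conclusion of the tree theorem
`…LocalHelicityTubeDoorTarget.localTubeDoorHelicity_of_windowRigidity`): classical NS solution on
[0,T), Leray–Hopf from a rapidly decaying datum, locally Type I at (x₀,T) on B(x₀,ρ) × ((T−ρ²)∨0,
T); if for ONE nonempty open window U of similarity coordinates the scale-normalised helicity
density fades in L¹, ∫_U |√(T−t)³ ⟪u(t), curl u(t)⟫(x₀+√(T−t)y)| dy → 0 as t → T⁻, then u is
backward bounded at (x₀,T). -/
@[route_item "route-NavierStokesRegularity-LocalHelicityTubeDoor"]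
def Target : Prop :=
  ∀ (ν T : ℝ), 0 < ν → 0 < T → ∀ (u : ℝ → EuclideanSpace ℝ (Fin 3) → EuclideanSpace ℝ (Fin 3)) (p : ℝ → EuclideanSpace ℝ (Fin 3) → ℝ), Literature.Analysis.FluidPDE.IsClassicalNSSolutionOn (Set.Ico 0 T) ν 0 u p → Literature.Analysis.FluidPDE.IsLerayHopfOn T ν 0 (u 0) u → Literature.Analysis.FluidPDE.HasRapidSpatialDecay (u 0) → ∀ (x₀ : EuclideanSpace ℝ (Fin 3)) (ρ M : ℝ), 0 < ρ → (∀ t ∈ Set.Ico 0 T, T - ρ ^ 2 < t → ∀ x ∈ Metric.ball x₀ ρ, ‖u t x‖ * Real.sqrt (ν * (T - t)) ≤ M) → ∀ (U : Set (EuclideanSpace ℝ (Fin 3))), IsOpen U → U.Nonempty → Filter.Tendsto (fun t => ∫⁻ y in U, ENNReal.ofReal |Real.sqrt (T - t) ^ 3 * inner ℝ (u t (x₀ + Real.sqrt (T - t) • y)) (Literature.Analysis.FluidPDE.curl (u t) (x₀ + Real.sqrt (T - t) • y))|) (nhdsWithin T (Set.Iio T)) (nhds 0) → Literature.Analysis.FluidPDE.IsBackwardBoundedAt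 u T x₀

/-- item stmt-NavierStokesRegularity-19977 · assembly · rank 1 · closed · proved by Summit.NavierStokesRegularity.NavierStokesRegularity.Theorems.LocalHelicityTubeDoorAssembly.assembly_proof (prover) · by operator
sources: arXiv:1811.00502, arXiv:0709.3599
[assembly] LocalPointZoomVelCurlSlices → FrobeniusProfileRigidity → the leaf LocalTubeDoorHelicity
(Target). -/
@[route_item "route-NavierStokesRegularity-LocalHelicityTubeDoor"]
def Assembly : Prop :=
  LocalPointZoomVelCurlSlices → FrobeniusProfileRigidity → Target

-- `Assembly` holds: proved by `Summit.NavierStokesRegularity.NavierStokesRegularity.Theorems.LocalHelicityTubeDoorAssembly.assembly_proof` (its module imports this route file, so no `_holds` link can be stated here).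

attribute [summit_statement] _root_.Summit.NavierStokesRegularity.NavierStokesRegularity.Theses.LocalHelicityTubeDoor.Target

/-! D-0027 §2.1 — DECIDING THEOREM (planner-authored via `route open/edit --closes-file`; by operator:999:1898382 2026-08-27T03:34:42Z):
its hypotheses are this route's items and its conclusion the registered leaf `Summit.NavierStokesRegularity.NavierStokesRegularity.Theses.LocalHelicityTubeDoor.Target` (rung N0-LocalTubeDoorHelicity, D-0061) (glue_lint), and it elaborates with this file. -/

/-- DECIDING THEOREM (D-0027 §2.1). Both cruxes are consumed: the tree glue
`…Theorems.LocalHelicityTubeDoorTarget.localTubeDoorHelicity_of` (K1‴ → K2⁗-in-window-form → leaf: zoom along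
`tⱼ = T + λⱼ² s/ν`, the normalised window helicity density converges pointwise to `σ³ν² ⟪v s, curl (v s)⟫(σ·)`,
Fatou on `∫⁻_U`, a.e.-to-everywhere by continuity of the slice helicity density) composed with the tree reduction
`…Theorems.LocalHelicityTubeDoorFrobeniusWindowRigidityWindow.frobeniusWindowRigidity_of_profileRigidity`
(window → whole slice by real analyticity of Oseen-mild Type-I slices). -/
@[closes "route-NavierStokesRegularity-LocalHelicityTubeDoor"] theorem closes (h₁ : LocalPointZoomVelCurlSlices) (h₂ : FrobeniusProfileRigidity) : Target :=
  Summit.NavierStokesRegularity.NavierStokesRegularity.Theorems.LocalHelicityTubeDoorTarget.localTubeDoorHelicity_of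
    h₁
    (Summit.NavierStokesRegularity.NavierStokesRegularity.Theorems.LocalHelicityTubeDoorFrobeniusWindowRigidityWindow.frobeniusWindowRigidity_of_profileRigidity
      h₂)

end Summit.NavierStokesRegularity.NavierStokesRegularity.Theses.LocalHelicityTubeDoor
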